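import Literature.AlgebraicGeometry.Motives.AbelianVarietyLatticeTensor
import Literature.AlgebraicGeometry.Motives.AbelianVarietyEquivariantIsogenyCharacter
import Literature.AlgebraicGeometry.Motives.AbelianVarietyTorsionCubeProofs
import Literature.AlgebraicGeometry.Motives.TateAbelianFiniteLatticeProofs
import HarnessLib

/-!
# Functoriality of `Y ⊗_ℤ M` in the lattice: intertwiners `P m(g) = n(g) P` give `G`-homomorphisms `Y ⊗ M → Y ⊗ N`
# (and conversely for `Y ≠ 0`), lattices isomorphic over `ℚ` give `G`-EQUIVARIANTLY ISOGENOUS tensors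
# (Mazur–Rubin–Silverberg Cor. 1.7, Cor. 1.9, Lemma 2.4), with equal characters and equal `dim B_H`, `dim B_W`

Sequel of `Motives/AbelianVarietyLatticeTensor` (independent of `…LatticeTensorHom`).  Two powers `X = Y ⊗ ℤ^ι` (bicone `b`) and `X' = Y ⊗ ℤ^κ` (bicone `c`) of
the same abelian variety `Y` over a field `K` carry the actions `ρ`, `ρ'` of `G` attached to integral matrix representations
`m : G → M_ι(ℤ)`, `n : G → M_κ(ℤ)` (lattices `M`, `N`) and a common twist `β : G → End Y`:
`ι_j ≫ ρ(g) ≫ π_i = m(g)_{ij} • β(g)`, `ι_l ≫ ρ'(g) ≫ π_k = n(g)_{kl} • β(g)`.  An integer matrix `P ∈ M_{κ×ι}(ℤ)` acts as the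
homomorphism `P_Y : X → X'` with blocks `ι_j ≫ P_Y ≫ π_k = P_{kj} • 𝟙_Y` (the functorial map `Hom_ℤ(M, N) → Hom(Y ⊗ M, Y ⊗ N)`,
`f ↦ f_V`, of MRS Cor. 1.7 (i); it exists and is unique by the prequel's `exists_hom_of_blocks` / `hom_ext_of_blocks`).  This file
proves (theorems only; `P`, `Q`, `m`, `n`, `β`, `ρ`, `ρ'` and the block identities are hypotheses):

* §1 EQUIVARIANCE: **if `P m(g) = n(g) P` for all `g` (an intertwiner, `P ∈ Hom_{ℤ[G]}(M, N)`), then `P_Y` is `G`-equivariant**,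
  `ρ(g) ≫ P_Y = P_Y ≫ ρ'(g)` (`comm_of_intertwines`; MRS Cor. 1.7 (ii): `Hom_{𝒪[G]}(I, J) → Hom_k(I ⊗ V, J ⊗ V)`; Serre §1.1
  "`T R_s = R'_s T`"), more generally for blocks `P_{kj} • ψ` with `ψ` commuting with the twist; and CONVERSELY, **for `Y ≠ 0` an
  equivariant `P_Y` comes from an intertwiner** (`intertwines_of_comm`; MRS Cor. 1.7 (iii): injectivity when `𝒪 → End V` is
  injective — here `ℤ → End Y`, `a ↦ a • 𝟙`, is injective for `dim Y > 0`, `zsmul_id_injective`);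
* §2 ISOGENIES: if `Q P = d · 1_ι` then **`P_Y ≫ Q_Y = d • 𝟙`** (`comp_eq_zsmul_id_of_blocks`), so for `Q P = d · 1`, `P Q = d · 1`,
  `d ≠ 0` **both `P_Y` and `Q_Y` are isogenies** (`isIsogeny_of_blocks`; MRS Lemma 2.4: "`t ∘ s` and `s ∘ t` are both
  multiplication by `n²`, therefore `s_V` is an isogeny"; any characteristic, `[d]` being an isogeny by the tree's
  `isIsogeny_zsmul_id_holds`); in particular **`det P ≠ 0 ⇒ P_Y` is an isogeny** with quasi-inverse `adj(P)_Y`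
  (`isIsogeny_of_blocks_of_det_ne_zero`, `P adj P = adj P · P = det P · 1`), and `P ∈ GL_ι(ℤ)` gives inverse isomorphisms
  (`comp_eq_id_of_blocks`; MRS Cor. 1.9);
* §3 THE MATRIX ALGEBRA OF A QUASI-INVERSE PAIR: if `P` intertwines `m`, `n` and `Q P = d·1`, `P Q = d·1`, `d ≠ 0`, then `Q`
  intertwines `n`, `m` (`intertwines_of_quasiInverse`), `adj(P)` intertwines when `det P ≠ 0` (`adjugate_intertwines`), and
  **`tr m(g) = tr n(g)`** (`trace_eq_trace_of_intertwines`: lattices in the same `ℚ[G]`-module have the same character);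
* §4 THE TENSORS OF `ℚ`-EQUIVALENT LATTICES ARE `G`-ISOGENOUS: **there are mutually quasi-inverse `G`-EQUIVARIANT ISOGENIES
  `P_Y : Y ⊗ M ⇄ Y ⊗ N : Q_Y`**, `P_Y Q_Y = Q_Y P_Y = [d]` (`exists_equivariant_isogeny_pair`; MRS Lemma 2.4 / Cor. 1.9 / Cor. 2.5:
  "`I ≅ J` over `ℚ` ⇒ `I ⊗ V ∼ J ⊗ V`"), hence over ANY field **`dim B_H(Y ⊗ M) = dim B_H(Y ⊗ N)`** for every finite subgroup
  (`dim_image_norm_eq_of_intertwines`) and **`dim B_W(Y ⊗ M) = dim B_W(Y ⊗ N)`** for every isotypical component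
  (`dim_isotypical_eq_of_intertwines`), by the tree's invariance of factor dimensions under equivariant isogeny
  (`Motives/AbelianVarietyEquivariantIsogenyCharacter`).

Scope (stated, not hidden).  `ι`, `κ` finite; `G` arbitrary (finite where isotypical data occur); `K` any field; the twist `β` is the
same on both sides; no Galois twisting.

## References

* [MazurRubinSilverberg2007] B. Mazur, K. Rubin, A. Silverberg, *Twisting commutative algebraic groups*, J. Algebra 314 (2007):
  Cor. 1.7 (i)–(iii) (`Hom_𝒪(I, J) → Hom(I ⊗ V, J ⊗ V)`, restricting to `Hom_{𝒪[G_k]}(I, J) → Hom_k`; injective if `𝒪 → End V` is),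
  Thm. 1.8, Cor. 1.9 (`I ≅ J` ⇒ `I ⊗ V ≅ J ⊗ V`), Lemma 2.4 (an isogeny `s : I → J` induces an isogeny `s_V`; proof via
  `t ∘ s = s ∘ t = n²`), Cor. 2.5 (`I ⊗ ℚ ≅ ⊕ J_i ⊗ ℚ ⇒ I ⊗ V ∼ ⊕ J_i ⊗ V`).  Held `paper:doi-10-1016-j-jalgebra-2007-02-052`, pp. 5–7 read.
* [Milne1972ArithmeticAV] J. S. Milne, *On the arithmetic of abelian varieties*, Invent. Math. 17 (1972), §2, as reported by
  [MazurRubinSilverberg2007].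
* [SerreLinearRepresentations1977] J.-P. Serre, *Linear Representations of Finite Groups*, GTM 42, §1.1 (similar representations in
  matrix form: `T · R_s = R'_s · T`), §2.1 Prop. 1 and the remark that similar representations have the same character, §2.3
  Cor. 2 ("two representations with the same character are isomorphic").  Held, PDF pp. 9, 15, 19 read.
* [LangeRodriguez2022] H. Lange, R. E. Rodríguez, *Decomposition of Jacobians by Prym Varieties*, LNM 2310 (2022), §2.9.1 Cor. 2.9.2
  and Prop. 2.9.3 (PDF pp. 43, 46).
* [KaniRosen1989] E. Kani, M. Rosen, *Idempotent relations and factors of Jacobians*, Math. Ann. 284 (1989), §3.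
* [MumfordAV1970] D. Mumford, *Abelian Varieties* (1970), §19 Thm. 3 (p. 176), remark p. 169 (quasi-inverse isogenies), §6
  Application 3 (p. 64: `[n]` is an isogeny).
-/

noncomputable section

open CategoryTheory CategoryTheory.Limits
open Literature.NumberTheory.DiophantineGeometry
open Literature.RepresentationTheory.FiniteGroups

universe u

namespace Literature.AlgebraicGeometry.Motives

namespace AbelianVariety

namespace LatticeTensor

variable {K : Type u} [Field K]

/-! ## §1 Intertwiners give equivariant homomorphisms `Y ⊗ M → Y ⊗ N`, and conversely for `Y ≠ 0` -/

section Equivariance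

variable {Y : AbelianVariety K} {ι κ : Type} [Fintype ι] [Fintype κ] [DecidableEq ι] [DecidableEq κ]
  (b : Bicone (fun _ : ι ↦ Y)) (c : Bicone (fun _ : κ ↦ Y)) {G : Type} [Group G]
  (m : G →* Matrix ι ι ℤ) (n : G →* Matrix κ κ ℤ) (β : G →* End Y) (ρ : G →* End b.pt) (ρ' : G →* End c.pt)

/-- **An intertwiner gives a `G`-homomorphism (general twist-compatible blocks)**: if `P m(g) = n(g) P` for all `g` and
`F : Y ⊗ M → Y ⊗ N` has blocks `ι_j ≫ F ≫ π_k = P_{kj} • ψ` with `ψ` commuting with the twist `β`, then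
**`ρ(g) ≫ F = F ≫ ρ'(g)`** — both sides have blocks `(n(g) P)_{kj} • (β(g) ψ)`. [cite: MazurRubinSilverberg2007, Cor. 1.7 (ii) and Prop. 1.6 (ii)]
[cite: SerreLinearRepresentations1977, §1.1 (`T · R_s = R'_s · T`)] -/
theorem comm_of_intertwines_of_blocks (hb : ∑ j, b.π j ≫ b.ι j = 𝟙 b.pt) (hc : ∑ k, c.π k ≫ c.ι k = 𝟙 c.pt)
    (hρ : ∀ (g : G) (i j : ι), b.ι j ≫ End.asHom (ρ g) ≫ b.π i = m g i j • End.asHom (β g))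
    (hρ' : ∀ (g : G) (k l : κ), c.ι l ≫ End.asHom (ρ' g) ≫ c.π k = n g k l • End.asHom (β g))
    {F : b.pt ⟶ c.pt} {P : Matrix κ ι ℤ} {ψ : Y ⟶ Y} (hF : ∀ (k : κ) (j : ι), b.ι j ≫ F ≫ c.π k = P k j • ψ)
    (hψ : ∀ g : G, End.asHom (β g) ≫ ψ = ψ ≫ End.asHom (β g)) (hP : ∀ g : G, P * m g = n g * P) (g : G) :
    End.asHom (ρ g) ≫ F = F ≫ End.asHom (ρ' g) := by
  refine hom_ext_of_blocks b c hb hc (P := n g * P) (φ := ψ ≫ End.asHom (β g)) (fun k j ↦ ?_) (fun k j ↦ ?_)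
  · rw [blocks_comp b b c hb (hρ g) hF k j, hP g, hψ g]
  · rw [blocks_comp b c c hc hF (hρ' g) k j]

/-- **An intertwiner `P ∈ Hom_{ℤ[G]}(M, N)` gives a `G`-homomorphism `P_Y : Y ⊗ M → Y ⊗ N`**: if `P m(g) = n(g) P` for all `g` and
`ι_j ≫ F ≫ π_k = P_{kj} • 𝟙_Y`, then **`ρ(g) ≫ F = F ≫ ρ'(g)`** — the restriction `Hom_{𝒪[G]}(I, J) → Hom_k(I ⊗ V, J ⊗ V)` of the
functorial map. [cite: MazurRubinSilverberg2007, Cor. 1.7 (ii)] [cite: SerreLinearRepresentations1977, §1.1 (`T · R_s = R'_s · T`)] -/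
theorem comm_of_intertwines (hb : ∑ j, b.π j ≫ b.ι j = 𝟙 b.pt) (hc : ∑ k, c.π k ≫ c.ι k = 𝟙 c.pt)
    (hρ : ∀ (g : G) (i j : ι), b.ι j ≫ End.asHom (ρ g) ≫ b.π i = m g i j • End.asHom (β g))
    (hρ' : ∀ (g : G) (k l : κ), c.ι l ≫ End.asHom (ρ' g) ≫ c.π k = n g k l • End.asHom (β g))
    {F : b.pt ⟶ c.pt} {P : Matrix κ ι ℤ} (hF : ∀ (k : κ) (j : ι), b.ι j ≫ F ≫ c.π k = P k j • 𝟙 Y)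
    (hP : ∀ g : G, P * m g = n g * P) (g : G) :
    End.asHom (ρ g) ≫ F = F ≫ End.asHom (ρ' g) :=
  comm_of_intertwines_of_blocks b c m n β ρ ρ' hb hc hρ hρ' hF
    (fun g ↦ by rw [Category.comp_id, Category.id_comp]) hP g

/-- **`ℤ → End Y`, `a ↦ a • 𝟙_Y`, is injective for `Y ≠ 0`**: `a • 𝟙_Y = a' • 𝟙_Y ⇒ a = a'` (apply the `ℓ`-adic
trace for a prime `ℓ` invertible in `K`: `a · 2 dim Y = a' · 2 dim Y` in `ℤ_ℓ`, with `dim Y > 0`). [cite: MazurRubinSilverberg2007, Cor. 1.7 (iii) (hypothesis "`𝒪 → End V` injective")]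
[cite: MumfordAV1970, §19 Thm. 4 (p. 180)] -/
theorem zsmul_id_injective (hY : 0 < Y.dim) {a a' : ℤ} (h : a • 𝟙 Y = a' • 𝟙 Y) : a = a' := by
  obtain ⟨ℓ, hℓp, hℓ⟩ := exists_prime_natCast_ne_zero (K := K)
  haveI : Fact ℓ.Prime := ⟨hℓp⟩
  have h1 := congrArg (fun φ : Y ⟶ Y ↦ LinearMap.trace ℤ_[ℓ] (Y.tateModule ℓ) (tateModuleMap ℓ φ)) h
  rw [tateModuleMap_zsmul, tateModuleMap_zsmul, map_zsmul, map_zsmul, trace_tateModuleMap_id_eq_two_mul_dim ℓ Y hℓ,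
    zsmul_eq_mul, zsmul_eq_mul] at h1
  have h2 : ((2 * Y.dim : ℕ) : ℤ_[ℓ]) ≠ 0 := Nat.cast_ne_zero.2 (by omega)
  exact_mod_cast mul_right_cancel₀ h2 h1

/-- Cancelling the twist: `a • β(g) = a' • β(g) ⇒ a • 𝟙 = a' • 𝟙` (`β(g)` is invertible with inverse `β(g⁻¹)`).
[cite: SerreLinearRepresentations1977, §1.1 (`ρ(s⁻¹) = ρ(s)⁻¹`)] -/
theorem zsmul_id_eq_of_zsmul_asHom_eq (g : G) {a a' : ℤ} (h : a • End.asHom (β g) = a' • End.asHom (β g)) :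
    a • 𝟙 Y = a' • 𝟙 Y := by
  have h1 := congrArg (fun φ : Y ⟶ Y ↦ φ ≫ End.asHom (β g⁻¹)) h
  simpa only [Preadditive.zsmul_comp, asHom_comp_asHom_inv] using h1

/-- **Conversely, for `Y ≠ 0` an equivariant scalar-block map comes from an intertwiner**: if `dim Y > 0`,
`ι_j ≫ F ≫ π_k = P_{kj} • 𝟙_Y` and `ρ(g) ≫ F = F ≫ ρ'(g)`, then **`P m(g) = n(g) P`** — the map `Hom_ℤ(M, N) → Hom(Y ⊗ M, Y ⊗ N)` is
injective and detects equivariance ("if the map `𝒪 → End_k(V)` is injective, then the maps in (i) and (ii) are injective").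
[cite: MazurRubinSilverberg2007, Cor. 1.7 (iii)] [cite: SerreLinearRepresentations1977, §1.1] -/
theorem intertwines_of_comm (hY : 0 < Y.dim) (hb : ∑ j, b.π j ≫ b.ι j = 𝟙 b.pt) (hc : ∑ k, c.π k ≫ c.ι k = 𝟙 c.pt)
    (hρ : ∀ (g : G) (i j : ι), b.ι j ≫ End.asHom (ρ g) ≫ b.π i = m g i j • End.asHom (β g))
    (hρ' : ∀ (g : G) (k l : κ), c.ι l ≫ End.asHom (ρ' g) ≫ c.π k = n g k l • End.asHom (β g))
    {F : b.pt ⟶ c.pt} {P : Matrix κ ι ℤ} (hF : ∀ (k : κ) (j : ι), b.ι j ≫ F ≫ c.π k = P k j • 𝟙 Y) {g : G}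
    (hcomm : End.asHom (ρ g) ≫ F = F ≫ End.asHom (ρ' g)) : P * m g = n g * P := by
  refine Matrix.ext fun k j ↦ zsmul_id_injective hY (zsmul_id_eq_of_zsmul_asHom_eq β g ?_)
  have h1 := blocks_comp b b c hb (hρ g) hF k j
  have h2 := blocks_comp b c c hc hF (hρ' g) k j
  rw [Category.comp_id, hcomm, h2, Category.id_comp] at h1
  exact h1.symm

end Equivariance

/-! ## §2 `Q P = d · 1 ⇒ P_Y ≫ Q_Y = [d]`: quasi-inverse pairs and isogenies from integer matrices -/

section Isogeny

variable {Y : AbelianVariety K} {ι κ : Type} [Fintype ι] [Fintype κ] [DecidableEq ι] [DecidableEq κ]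
  (b : Bicone (fun _ : ι ↦ Y)) (c : Bicone (fun _ : κ ↦ Y))

omit [DecidableEq κ] in
/-- **`P_Y ≫ Q_Y = d • 𝟙` when `Q P = d · 1`**: the composite of the scalar-block maps of `P ∈ M_{κ×ι}(ℤ)` and `Q ∈ M_{ι×κ}(ℤ)` has
blocks `(Q P)_{ij} • 𝟙 = d δ_{ij} • 𝟙`, the blocks of `[d]` ("`t ∘ s` and `s ∘ t` are both multiplication by `n²`").
[cite: MazurRubinSilverberg2007, Lemma 2.4 (proof) and Thm. 1.8] [cite: SerreLinearRepresentations1977, §1.1] -/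
theorem comp_eq_zsmul_id_of_blocks (hb : ∑ j, b.π j ≫ b.ι j = 𝟙 b.pt) (hc : ∑ k, c.π k ≫ c.ι k = 𝟙 c.pt)
    {F : b.pt ⟶ c.pt} {F' : c.pt ⟶ b.pt} {P : Matrix κ ι ℤ} {Q : Matrix ι κ ℤ} {d : ℤ}
    (hF : ∀ (k : κ) (j : ι), b.ι j ≫ F ≫ c.π k = P k j • 𝟙 Y) (hF' : ∀ (i : ι) (k : κ), c.ι k ≫ F' ≫ b.π i = Q i k • 𝟙 Y)
    (hQP : Q * P = d • (1 : Matrix ι ι ℤ)) : F ≫ F' = d • 𝟙 b.pt := by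
  refine hom_ext_of_blocks b b hb hb (P := d • (1 : Matrix ι ι ℤ)) (φ := 𝟙 Y) (fun i j ↦ ?_)
    (fun i j ↦ blocks_zsmul b b (fun i' j' ↦ blocks_id b i' j') d i j)
  rw [blocks_comp b c b hc hF hF' i j, hQP, Category.comp_id]

omit [DecidableEq κ] in
/-- **`P ∈ GL`: `Q P = 1 ⇒ P_Y ≫ Q_Y = 𝟙`** — an isomorphism of lattices gives an isomorphism `Y ⊗ M ≅ Y ⊗ N` (with inverse `Q_Y` when
also `P Q = 1`). [cite: MazurRubinSilverberg2007, Cor. 1.9 and Thm. 1.8] -/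
theorem comp_eq_id_of_blocks (hb : ∑ j, b.π j ≫ b.ι j = 𝟙 b.pt) (hc : ∑ k, c.π k ≫ c.ι k = 𝟙 c.pt)
    {F : b.pt ⟶ c.pt} {F' : c.pt ⟶ b.pt} {P : Matrix κ ι ℤ} {Q : Matrix ι κ ℤ}
    (hF : ∀ (k : κ) (j : ι), b.ι j ≫ F ≫ c.π k = P k j • 𝟙 Y) (hF' : ∀ (i : ι) (k : κ), c.ι k ≫ F' ≫ b.π i = Q i k • 𝟙 Y)
    (hQP : Q * P = 1) : F ≫ F' = 𝟙 b.pt := by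
  have h := comp_eq_zsmul_id_of_blocks b c hb hc hF hF' (d := 1) (by rw [hQP, one_smul])
  rwa [one_smul] at h

/-- **Quasi-inverse integer matrices give mutually quasi-inverse ISOGENIES** (any characteristic): if `Q P = d · 1_ι`, `P Q = d · 1_κ`
with `d ≠ 0`, then `P_Y ≫ Q_Y = [d]`, `Q_Y ≫ P_Y = [d]` and **both `P_Y : Y ⊗ M → Y ⊗ N` and `Q_Y` are isogenies** (`[d]` is an
isogeny, the tree's `isIsogeny_zsmul_id_holds`, and a factor of an isogeny through an isogeny pair is an isogeny,
`isIsogeny_of_comp_eq_of_comp_eq`). [cite: MazurRubinSilverberg2007, Lemma 2.4] [cite: MumfordAV1970, §19 remark p. 169 and §6 Application 3 (p. 64)] -/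
theorem isIsogeny_of_blocks (hb : ∑ j, b.π j ≫ b.ι j = 𝟙 b.pt) (hc : ∑ k, c.π k ≫ c.ι k = 𝟙 c.pt)
    {F : b.pt ⟶ c.pt} {F' : c.pt ⟶ b.pt} {P : Matrix κ ι ℤ} {Q : Matrix ι κ ℤ} {d : ℤ}
    (hF : ∀ (k : κ) (j : ι), b.ι j ≫ F ≫ c.π k = P k j • 𝟙 Y) (hF' : ∀ (i : ι) (k : κ), c.ι k ≫ F' ≫ b.π i = Q i k • 𝟙 Y)
    (hQP : Q * P = d • (1 : Matrix ι ι ℤ)) (hPQ : P * Q = d • (1 : Matrix κ κ ℤ)) (hd : d ≠ 0) :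
    IsIsogeny F ∧ IsIsogeny F' ∧ F ≫ F' = d • 𝟙 b.pt ∧ F' ≫ F = d • 𝟙 c.pt := by
  have h1 := comp_eq_zsmul_id_of_blocks b c hb hc hF hF' hQP
  have h2 := comp_eq_zsmul_id_of_blocks c b hc hb hF' hF hPQ
  exact ⟨isIsogeny_of_comp_eq_of_comp_eq (isIsogeny_zsmul_id_holds c.pt d hd) (isIsogeny_zsmul_id_holds b.pt d hd) h2 h1,
    isIsogeny_of_comp_eq_of_comp_eq (isIsogeny_zsmul_id_holds b.pt d hd) (isIsogeny_zsmul_id_holds c.pt d hd) h1 h2, h1, h2⟩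

variable (b' : Bicone (fun _ : ι ↦ Y))

/-- **`det P ≠ 0 ⇒ P_Y` is an isogeny** between two powers `Y^ι` (square `P ∈ M_ι(ℤ)`; any characteristic): the map of the adjugate
matrix is a quasi-inverse, `P · adj P = adj P · P = det P · 1`, so `P_Y ≫ adj(P)_Y = adj(P)_Y ≫ P_Y = [det P]`.
[cite: MazurRubinSilverberg2007, Lemma 2.4] [cite: MumfordAV1970, §19 remark p. 169] -/
theorem isIsogeny_of_blocks_of_det_ne_zero (hb : ∑ j, b.π j ≫ b.ι j = 𝟙 b.pt) (hb' : ∑ j, b'.π j ≫ b'.ι j = 𝟙 b'.pt)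
    {F : b.pt ⟶ b'.pt} {P : Matrix ι ι ℤ} (hF : ∀ (k : ι) (j : ι), b.ι j ≫ F ≫ b'.π k = P k j • 𝟙 Y) (hP : P.det ≠ 0) :
    IsIsogeny F ∧ ∃ F' : b'.pt ⟶ b.pt, (∀ (i k : ι), b'.ι k ≫ F' ≫ b.π i = P.adjugate i k • 𝟙 Y) ∧ IsIsogeny F' ∧
      F ≫ F' = P.det • 𝟙 b.pt ∧ F' ≫ F = P.det • 𝟙 b'.pt := by
  obtain ⟨F', hF'⟩ := exists_hom_of_blocks b' b P.adjugate (𝟙 Y)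
  obtain ⟨h1, h2, h3, h4⟩ := isIsogeny_of_blocks b b' hb hb' hF hF' (Matrix.adjugate_mul P) (Matrix.mul_adjugate P) hP
  exact ⟨h1, F', hF', h2, h3, h4⟩

end Isogeny

/-! ## §3 The matrix algebra of a quasi-inverse pair: `Q` and `adj P` intertwine, and `tr m(g) = tr n(g)` -/

section MatrixAlgebra

variable {ι κ : Type} [Fintype ι] [Fintype κ] [DecidableEq ι] [DecidableEq κ] {G : Type} [Group G]
  (m : G →* Matrix ι ι ℤ) (n : G →* Matrix κ κ ℤ)

omit [Fintype ι] [Fintype κ] [DecidableEq ι] [DecidableEq κ] in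
/-- Cancelling a nonzero integer from a matrix identity: `d • A = d • B ⇒ A = B` (`ℤ` is a domain). [folklore] -/
private theorem eq_of_smul_eq_smul {d : ℤ} (hd : d ≠ 0) {A B : Matrix ι κ ℤ} (h : d • A = d • B) : A = B :=
  Matrix.ext fun i k ↦ mul_left_cancel₀ hd (by
    have := congrFun (congrFun h i) k
    simpa only [Matrix.smul_apply, smul_eq_mul] using this)

/-- **The quasi-inverse of an intertwiner intertwines**: `P m(g) = n(g) P`, `Q P = d · 1`, `P Q = d · 1`, `d ≠ 0` give
`Q n(g) = m(g) Q` (`d · Q n = Q n P Q = Q P m Q = d · m Q`; "`s ∘ t` and `t ∘ s` are multiplication by `n²`", the quasi-inverse of an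
equivariant isogeny of lattices is equivariant). [cite: MazurRubinSilverberg2007, Lemma 2.4] [cite: SerreLinearRepresentations1977, §1.1 (`R'_s = T R_s T⁻¹`)] -/
theorem intertwines_of_quasiInverse {P : Matrix κ ι ℤ} {Q : Matrix ι κ ℤ} {d : ℤ} (hP : ∀ g : G, P * m g = n g * P)
    (hQP : Q * P = d • (1 : Matrix ι ι ℤ)) (hPQ : P * Q = d • (1 : Matrix κ κ ℤ)) (hd : d ≠ 0) (g : G) :
    Q * n g = m g * Q := by
  refine eq_of_smul_eq_smul hd ?_
  calc d • (Q * n g) = Q * n g * (P * Q) := by rw [hPQ, Matrix.mul_smul, Matrix.mul_one]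
    _ = Q * (P * m g) * Q := by rw [hP g]; simp only [Matrix.mul_assoc]
    _ = d • (m g * Q) := by rw [← Matrix.mul_assoc Q P, hQP, Matrix.smul_mul, Matrix.one_mul, Matrix.smul_mul]

/-- **The adjugate of an intertwiner with `det P ≠ 0` intertwines**: `P m(g) = n(g) P ⇒ adj(P) n(g) = m(g) adj(P)` (for square `P`;
the quasi-inverse pair `P adj P = adj P · P = det P · 1`). [cite: MazurRubinSilverberg2007, Lemma 2.4]
[cite: SerreLinearRepresentations1977, §1.1 (`R'_s = T R_s T⁻¹`)] -/
theorem adjugate_intertwines {n' : G →* Matrix ι ι ℤ} {P : Matrix ι ι ℤ} (hP : ∀ g : G, P * m g = n' g * P)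
    (hdet : P.det ≠ 0) (g : G) : P.adjugate * n' g = m g * P.adjugate :=
  intertwines_of_quasiInverse m n' hP (Matrix.adjugate_mul P) (Matrix.mul_adjugate P) hdet g

/-- **Lattices isomorphic over `ℚ` have the same character: `tr m(g) = tr n(g)`** when `P m(g) = n(g) P` for a `P` with a
quasi-inverse `Q`, `Q P = d · 1`, `P Q = d · 1`, `d ≠ 0` (`d · tr n = tr(n P Q) = tr(Q n P) = tr(Q P m) = d · tr m`; "similar
representations have the same character"). [cite: SerreLinearRepresentations1977, §2.1 Prop. 1 (iii) (`Tr(ab) = Tr(ba)`) and §1.1]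
[cite: MazurRubinSilverberg2007, Lemma 2.4 and Cor. 2.5] -/
theorem trace_eq_trace_of_intertwines {P : Matrix κ ι ℤ} {Q : Matrix ι κ ℤ} {d : ℤ} (hP : ∀ g : G, P * m g = n g * P)
    (hQP : Q * P = d • (1 : Matrix ι ι ℤ)) (hPQ : P * Q = d • (1 : Matrix κ κ ℤ)) (hd : d ≠ 0) (g : G) :
    (m g).trace = (n g).trace := by
  refine mul_left_cancel₀ hd ?_
  calc d * (m g).trace = (Q * P * m g).trace := by
        rw [hQP, Matrix.smul_mul, Matrix.one_mul, Matrix.trace_smul, smul_eq_mul]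
    _ = (Q * (n g * P)).trace := by rw [Matrix.mul_assoc, hP g]
    _ = (n g * P * Q).trace := by rw [Matrix.trace_mul_comm]
    _ = d * (n g).trace := by
        rw [Matrix.mul_assoc, hPQ, Matrix.mul_smul, Matrix.mul_one, Matrix.trace_smul, smul_eq_mul]

end MatrixAlgebra

/-! ## §4 `ℚ`-equivalent lattices give `G`-equivariantly isogenous tensors, with equal `dim B_H`, `dim B_W` over any field -/

section EquivariantIsogeny

variable {Y : AbelianVariety K} {ι κ : Type} [Fintype ι] [Fintype κ] [DecidableEq ι] [DecidableEq κ]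
  (b : Bicone (fun _ : ι ↦ Y)) (c : Bicone (fun _ : κ ↦ Y)) {G : Type} [Group G]
  (m : G →* Matrix ι ι ℤ) (n : G →* Matrix κ κ ℤ) (β : G →* End Y) (ρ : G →* End b.pt) (ρ' : G →* End c.pt)

/-- **MRS Lemma 2.4 for `Y ⊗ M`, equivariantly: an intertwiner with a quasi-inverse gives a pair of mutually quasi-inverse
`G`-EQUIVARIANT ISOGENIES `P_Y : Y ⊗ M ⇄ Y ⊗ N : Q_Y`**, `P_Y Q_Y = [d] = Q_Y P_Y` — lattices isomorphic over `ℚ` (`P ∈ Hom_{ℤ[G]}(M, N)`,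
`Q P = d·1 = P Q`, `d ≠ 0`) have `G`-isogenous tensors ("`I ≅ J` as `𝒪[G_F]`-modules ⇒ `I ⊗ V ≅ J ⊗ V`"; "if `s` is an isogeny then
`s_V` is an isogeny"). [cite: MazurRubinSilverberg2007, Lemma 2.4, Cor. 1.9 and Cor. 2.5] [cite: SerreLinearRepresentations1977, §1.1] -/
theorem exists_equivariant_isogeny_pair (hb : ∑ j, b.π j ≫ b.ι j = 𝟙 b.pt) (hc : ∑ k, c.π k ≫ c.ι k = 𝟙 c.pt)
    (hρ : ∀ (g : G) (i j : ι), b.ι j ≫ End.asHom (ρ g) ≫ b.π i = m g i j • End.asHom (β g))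
    (hρ' : ∀ (g : G) (k l : κ), c.ι l ≫ End.asHom (ρ' g) ≫ c.π k = n g k l • End.asHom (β g))
    {P : Matrix κ ι ℤ} {Q : Matrix ι κ ℤ} {d : ℤ} (hP : ∀ g : G, P * m g = n g * P)
    (hQP : Q * P = d • (1 : Matrix ι ι ℤ)) (hPQ : P * Q = d • (1 : Matrix κ κ ℤ)) (hd : d ≠ 0) :
    ∃ (F : b.pt ⟶ c.pt) (F' : c.pt ⟶ b.pt), IsIsogeny F ∧ IsIsogeny F' ∧
      (∀ g : G, End.asHom (ρ g) ≫ F = F ≫ End.asHom (ρ' g)) ∧ (∀ g : G, End.asHom (ρ' g) ≫ F' = F' ≫ End.asHom (ρ g)) ∧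
      F ≫ F' = d • 𝟙 b.pt ∧ F' ≫ F = d • 𝟙 c.pt := by
  obtain ⟨F, hF⟩ := exists_hom_of_blocks b c P (𝟙 Y)
  obtain ⟨F', hF'⟩ := exists_hom_of_blocks c b Q (𝟙 Y)
  obtain ⟨h1, h2, h3, h4⟩ := isIsogeny_of_blocks b c hb hc hF hF' hQP hPQ hd
  exact ⟨F, F', h1, h2, comm_of_intertwines b c m n β ρ ρ' hb hc hρ hρ' hF hP,
    comm_of_intertwines c b n m β ρ' ρ hc hb hρ' hρ hF' (intertwines_of_quasiInverse m n hP hQP hPQ hd), h3, h4⟩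

/-- **`dim B_H(Y ⊗ M) = dim B_H(Y ⊗ N)` for lattices isomorphic over `ℚ`**, over ANY field and for every finite subgroup `H`
(`B_H = Im Σ_{h ∈ H} ρ(h)`): factor dimensions are invariant under the `G`-isogeny `P_Y` (the tree's `dim_image_norm_eq_of_isIsogeny`).
[cite: MazurRubinSilverberg2007, Lemma 2.4 and Cor. 2.5] [cite: LangeRodriguez2022, §2.9.1 Cor. 2.9.2 and Prop. 2.9.3 (PDF pp. 43, 46)]
[cite: KaniRosen1989, §3] -/
theorem dim_image_norm_eq_of_intertwines {H : Subgroup G} [Fintype H] (hb : ∑ j, b.π j ≫ b.ι j = 𝟙 b.pt)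
    (hc : ∑ k, c.π k ≫ c.ι k = 𝟙 c.pt)
    (hρ : ∀ (g : G) (i j : ι), b.ι j ≫ End.asHom (ρ g) ≫ b.π i = m g i j • End.asHom (β g))
    (hρ' : ∀ (g : G) (k l : κ), c.ι l ≫ End.asHom (ρ' g) ≫ c.π k = n g k l • End.asHom (β g))
    {P : Matrix κ ι ℤ} {Q : Matrix ι κ ℤ} {d : ℤ} (hP : ∀ g : G, P * m g = n g * P)
    (hQP : Q * P = d • (1 : Matrix ι ι ℤ)) (hPQ : P * Q = d • (1 : Matrix κ κ ℤ)) (hd : d ≠ 0)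
    {N : b.pt ⟶ b.pt} (hN : End.of N = ∑ h : H, ρ h) {N' : c.pt ⟶ c.pt} (hN' : End.of N' = ∑ h : H, ρ' h) :
    (image N).dim = (image N').dim := by
  obtain ⟨F, -, hFi, -, hF, -, -, -⟩ :=
    exists_equivariant_isogeny_pair b c m n β ρ ρ' hb hc hρ hρ' hP hQP hPQ hd
  exact dim_image_norm_eq_of_isIsogeny ρ ρ' hFi hF hN hN'

/-- **`dim B_W(Y ⊗ M) = dim B_W(Y ⊗ N)` for lattices isomorphic over `ℚ`**, over ANY field and for every isotypical component
`B_W = Im u_W`, `u_W = Σ_g c_W(g) ρ(g)` (same coefficient vectors `c` on both sides): the `G`-isogeny `P_Y` respects the isotypical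
decomposition (the tree's `dim_isotypical_eq_of_isIsogeny`). [cite: MazurRubinSilverberg2007, Lemma 2.4, Cor. 2.5 and Thm. 4.5]
[cite: LangeRodriguez2022, §2.9.1 Cor. 2.9.2, Thm. 2.9.1 and Prop. 2.9.3 (PDF pp. 43, 46)] -/
theorem dim_isotypical_eq_of_intertwines [Fintype G] (hb : ∑ j, b.π j ≫ b.ι j = 𝟙 b.pt) (hc : ∑ k, c.π k ≫ c.ι k = 𝟙 c.pt)
    (hρ : ∀ (g : G) (i j : ι), b.ι j ≫ End.asHom (ρ g) ≫ b.π i = m g i j • End.asHom (β g))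
    (hρ' : ∀ (g : G) (k l : κ), c.ι l ≫ End.asHom (ρ' g) ≫ c.π k = n g k l • End.asHom (β g))
    {P : Matrix κ ι ℤ} {Q : Matrix ι κ ℤ} {d : ℤ} (hP : ∀ g : G, P * m g = n g * P)
    (hQP : Q * P = d • (1 : Matrix ι ι ℤ)) (hPQ : P * Q = d • (1 : Matrix κ κ ℤ)) (hd : d ≠ 0)
    {c₀ : ratCharIdempotents G → G → ℤ}
    (hc₀ : ∀ e : ratCharIdempotents G,
      (Fintype.card G : ℚ) • (e : MonoidAlgebra ℚ G) = ∑ g, (c₀ e g : ℚ) • MonoidAlgebra.of ℚ G g)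
    {u : ratCharIdempotents G → (b.pt ⟶ b.pt)} (hu : ∀ e, End.of (u e) = ∑ g, c₀ e g • ρ g)
    {u' : ratCharIdempotents G → (c.pt ⟶ c.pt)} (hu' : ∀ e, End.of (u' e) = ∑ g, c₀ e g • ρ' g)
    (e : ratCharIdempotents G) : (image (u e)).dim = (image (u' e)).dim := by
  obtain ⟨F, -, hFi, -, hF, -, -, -⟩ :=
    exists_equivariant_isogeny_pair b c m n β ρ ρ' hb hc hρ hρ' hP hQP hPQ hd
  exact dim_isotypical_eq_of_isIsogeny ρ ρ' hFi hF hc₀ hu hu' e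

/-- **`Y ⊗ M ∼ Y ⊗ N` for lattices isomorphic over `ℚ`** (as abelian varieties; any field — the isogeny is the explicit `P_Y`,
`G`-equivariant by `exists_equivariant_isogeny_pair`). [cite: MazurRubinSilverberg2007, Lemma 2.4 and Cor. 2.5] -/
theorem isIsogenous_of_intertwines (hb : ∑ j, b.π j ≫ b.ι j = 𝟙 b.pt) (hc : ∑ k, c.π k ≫ c.ι k = 𝟙 c.pt)
    {P : Matrix κ ι ℤ} {Q : Matrix ι κ ℤ} {d : ℤ}
    (hQP : Q * P = d • (1 : Matrix ι ι ℤ)) (hPQ : P * Q = d • (1 : Matrix κ κ ℤ)) (hd : d ≠ 0) :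
    IsIsogenous b.pt c.pt := by
  obtain ⟨F, hF⟩ := exists_hom_of_blocks b c P (𝟙 Y)
  obtain ⟨F', hF'⟩ := exists_hom_of_blocks c b Q (𝟙 Y)
  exact ⟨F, (isIsogeny_of_blocks b c hb hc hF hF' hQP hPQ hd).1⟩

end EquivariantIsogeny

end LatticeTensor

end AbelianVariety

end Literature.AlgebraicGeometry.Motives
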